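import Summits.HodgeConjecture.CorCM.IrreducibleOddWeightsProductSpanConverse
import Summits.HodgeConjecture.CorCM.IrreducibleOddWeightsAdditivityHellyCMFields
import HarnessLib

/-!
# WHERE the first exceptional mixed class lives: if `Hg(∏_i A_i) ⊊ ∏_i Hg(A_i)`, a MINIMAL non-additive sub-family `T₀`
# has `|T₀| ≤ dim MT(A_i)` for every member `i ∈ T₀`, and `A_i^{a} × ∏_{j ∈ T₀ ∖ i} A_j^{b_j}` carries a rational Hodge
# class that is not a combination of exterior products

COR-CM (cell `pub-hodgecm2`, binder seat `b16` gen 60, count-neutral claim HODGE GLUING, file G10 — CM fields and their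
realisations; theorems only, no definition, no named fact, no `sorry`).  NEW as stated, hence under `Summits/`.  HONEST
FRAMING: an unconditional structure theorem on Hodge classes of products of CM abelian varieties; `HC_CM` is neither
used nor asserted.

G7 (`exists_not_hodgeClassesProductSpan_of_cmFamilyRank_add_card_ne`) produces, for a NON-additive family, disjoint
products of copies without the product-span property, through a minimal non-additive sub-family `T₀`.  Gen 59's
`card_le_cmTypeRank_of_minimal_nonadditive` (`IrreducibleOddWeightsAdditivityHellyCMFields`) bounds such `T₀` by
`|T₀| ≤ cmTypeRank Φ_i = dim MT(A_i)` for EVERY member.  Together: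

* **`exists_minimal_not_hodgeClassesProductSpan_of_cmFamilyRank_add_card_ne`** — `Hg(∏_i A_i) ⊊ ∏_i Hg(A_i)` ⟹ there are
  `T₀ ⊆ I`, `i ∈ T₀` and slot maps `π₁ ≡ i`, `π₂` into `T₀ ∖ {i}` with `¬ HodgeClassesProductSpan (⨁ A∘π₁) (⨁ A∘π₂)`, where
  every proper non-empty sub-family of `T₀` is additive and `|T₀| ≤ dim MT(A_j)` for all `j ∈ T₀`;
* **`exists_card_le_not_hodgeClassesProductSpan_of_cmTypeRank_le`** — if `dim MT(A_i) ≤ q + 1` for all `i` (e.g. `dim A_i ≤ q`,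
  `…_of_finrank_le`) the first exceptional mixed class lives on a product of copies of at most `q + 1` of the `A_i`;
* **`exists_pair_not_hodgeClassesProductSpan_of_cmTypeRank_eq_two`** — if the family contains a CM ELLIPTIC CURVE `E = A_{i₀}`
  (`cmTypeRank = 2`) taking part in a minimal failure … more precisely: if `Hg(∏ A_i) ⊊ ∏ Hg(A_i)` and EVERY member has
  `dim MT ≤ 2` (CM elliptic curves), the failure is visible on a PAIR `E^{a} × E'^{b}`.

## References

* [MoonenZarhin1999LowDim] B. Moonen, Yu. Zarhin, *Hodge classes on abelian varieties of low dimension*, Math. Ann.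
  315 (1999), §3 (3.1).
* [Mai1989] L. Mai, *Lower bounds for the ranks of CM types*, J. Number Theory 32 (1989), §2 Prop. 1 (proof).
* [Gordon1999HodgeAVSurvey] B. B. Gordon, *A survey of the Hodge conjecture for abelian varieties*, §3 and 7.5–7.7.
-/

set_option autoImplicit false

noncomputable section

open scoped BigOperators

open CategoryTheory CategoryTheory.Limits NumberField

namespace Summit.HodgeConjecture.CorCM

open Literature.NumberTheory.ComplexMultiplication
open Literature.AlgebraicGeometry.Motives (AbelianVariety CMType)
open Literature.AlgebraicGeometry.Motives.AbelianVariety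
open Literature.AlgebraicGeometry.HodgeTheory
open Literature.AlgebraicGeometry.ComplexMultiplication (IsCMTypeRealisation)
open Literature.AlgebraicGeometry.Milne1999 (flatIndex)
open Literature.AlgebraicGeometry.Pohlmann1968

variable {I : Type} [Fintype I] [DecidableEq I] {K : I → Type} [∀ i, Field (K i)] [∀ i, NumberField (K i)]
  [∀ i, IsCMField (K i)] {Φ : ∀ i, CMType (K i)} {A : I → AbelianVariety ℂ} {ιA : ∀ i, 𝓞 (K i) →+* End (A i)}
  {θ : ∀ i, K i →+* Module.End ℂ (complexBetti (A i).X 1)}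

/-- **THE FIRST EXCEPTIONAL MIXED CLASS LIVES ON A MINIMAL NON-ADDITIVE SUB-FAMILY, WHICH IS SMALL.**  Realisations
`A_i ⊨ (K_i; Φ_i)` of a family which is NOT additive (`Hg(∏_i A_i) ⊊ ∏_i Hg(A_i)`).  Then there are `T₀ ⊆ I` and `i ∈ T₀`
such that: every non-empty proper sub-family of `T₀` is additive, `T₀` is not, `|T₀| ≤ cmTypeRank Φ_j = dim MT(A_j)` for
EVERY `j ∈ T₀`, and for some `N₁, N₂ ≥ 1` and `π₂ : Fin N₂ → I` with values in `T₀ ∖ {i}` the product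
`A_i^{N₁} × ⨁_k A_{π₂ k}` carries a rational Hodge class that is NOT a `ℂ`-combination of exterior products of Hodge
classes of the two factors. [cite: MoonenZarhin1999LowDim, §3 (3.1)] [cite: Mai1989, §2 Prop. 1 (proof)] -/
theorem exists_minimal_not_hodgeClassesProductSpan_of_cmFamilyRank_add_card_ne [Nonempty I]
    (hA : ∀ i, IsCMTypeRealisation (Φ i) (A i) (ιA i) (θ i))
    (hne : CMAlgebra.cmFamilyRank Φ + Fintype.card I ≠ (∑ i, cmTypeRank (Φ i)) + 1) :
    ∃ (T₀ : Finset I) (i : I), i ∈ T₀ ∧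
      (CMAlgebra.cmFamilyRank (fun j : {j // j ∈ T₀} => Φ j.1) + T₀.card ≠ (∑ j ∈ T₀, cmTypeRank (Φ j)) + 1) ∧
      (∀ T : Finset I, T ⊂ T₀ → T.Nonempty →
        CMAlgebra.cmFamilyRank (fun j : {j // j ∈ T} => Φ j.1) + T.card = (∑ j ∈ T, cmTypeRank (Φ j)) + 1) ∧
      (∀ j ∈ T₀, T₀.card ≤ cmTypeRank (Φ j)) ∧
      ∃ (N₁ N₂ : ℕ) (_ : NeZero N₁) (_ : NeZero N₂) (π₂ : Fin N₂ → I),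
        (∀ k, π₂ k ∈ T₀.erase i) ∧ ¬ HodgeClassesProductSpan (⨁ fun _ : Fin N₁ => A i) (⨁ fun k => A (π₂ k)) := by
  classical
  let add : Finset I → Prop := fun T =>
    CMAlgebra.cmFamilyRank (fun j : {j // j ∈ T} => Φ j.1) + T.card = (∑ j ∈ T, cmTypeRank (Φ j)) + 1
  -- the a-priori inequality for every non-empty `T`
  have hle : ∀ T : Finset I, T.Nonempty →
      CMAlgebra.cmFamilyRank (fun j : {j // j ∈ T} => Φ j.1) + T.card ≤ (∑ j ∈ T, cmTypeRank (Φ j)) + 1 := by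
    intro T hT
    obtain ⟨j₀, hj₀⟩ := hT
    haveI : Nonempty {j // j ∈ T} := ⟨⟨j₀, hj₀⟩⟩
    haveI : ∀ j : {j // j ∈ T}, Nonempty (K j.1 →+* ℂ) := fun j => inferInstance
    have h := typeRank_sigmaType_add_card_le (G := ℂ ≃+* ℂ) (E := fun j : {j // j ∈ T} => K j.1 →+* ℂ)
      (Φ := fun j => (Φ j.1).1) fun j => isCMTypeWith_conj (Φ j.1)
    rw [Fintype.card_coe] at h
    have hsum : ∑ j : {j // j ∈ T}, typeRank (ℂ ≃+* ℂ) (Φ j.1).1 = ∑ j ∈ T, cmTypeRank (Φ j) :=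
      Finset.sum_coe_sort T fun j => cmTypeRank (Φ j)
    rw [hsum] at h
    exact h
  -- the whole family is a non-additive sub-family
  have huniv : ¬ add Finset.univ := by
    intro h
    apply hne
    have hr : CMAlgebra.cmFamilyRank (fun j : {j // j ∈ (Finset.univ : Finset I)} => Φ j.1) =
        CMAlgebra.cmFamilyRank Φ :=
      (CMAlgebra.cmFamilyRank_comp_of_surjective (fun j : {j // j ∈ (Finset.univ : Finset I)} => Φ j.1)
        (π := fun i : I => (⟨i, Finset.mem_univ i⟩ : {j // j ∈ (Finset.univ : Finset I)}))
        fun j => ⟨j.1, rfl⟩).symm.trans rfl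
    have h' : CMAlgebra.cmFamilyRank (fun j : {j // j ∈ (Finset.univ : Finset I)} => Φ j.1) + Finset.univ.card =
        (∑ j ∈ Finset.univ, cmTypeRank (Φ j)) + 1 := h
    rw [hr, Finset.card_univ] at h'
    exact h'
  -- a non-additive sub-family of least cardinality among the non-empty ones
  have hex : ∃ m, ∃ T : Finset I, T.Nonempty ∧ T.card = m ∧ ¬ add T :=
    ⟨_, Finset.univ, Finset.univ_nonempty, rfl, huniv⟩
  obtain ⟨T₀, hT₀ne, hT₀card, hT₀⟩ := Nat.find_spec hex
  have hmin : ∀ T : Finset I, T.Nonempty → T.card < T₀.card → add T := by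
    intro T hT hlt
    by_contra hbad
    exact Nat.find_min hex (hT₀card ▸ hlt) ⟨T, hT, rfl, hbad⟩
  have hmin' : ∀ T : Finset I, T ⊂ T₀ → T.Nonempty →
      CMAlgebra.cmFamilyRank (fun j : {j // j ∈ T} => Φ j.1) + T.card = (∑ j ∈ T, cmTypeRank (Φ j)) + 1 :=
    fun T hT hTne => hmin T hTne (Finset.card_lt_card hT)
  -- the bound on `|T₀|` (gen 59: minimal non-additive families are small)
  have hbound : ∀ j ∈ T₀, T₀.card ≤ cmTypeRank (Φ j) := fun j hj =>
    card_le_cmTypeRank_of_minimal_nonadditive Φ T₀ hT₀ hmin' hj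
  -- `T₀` has at least two members
  obtain ⟨i, hi⟩ := hT₀ne
  have hT₀2 : (T₀.erase i).Nonempty := by
    rw [← Finset.card_pos, Finset.card_erase_of_mem hi]
    by_contra h0
    have h1 : T₀.card = 1 := by have := Finset.card_pos.2 ⟨i, hi⟩; omega
    obtain ⟨i', hi'⟩ := Finset.card_eq_one.1 h1
    subst hi'
    apply hT₀
    change CMAlgebra.cmFamilyRank (fun j : {j // j ∈ ({i'} : Finset I)} => Φ j.1) + ({i'} : Finset I).card =
      (∑ j ∈ ({i'} : Finset I), cmTypeRank (Φ j)) + 1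
    rw [Finset.card_singleton, Finset.sum_singleton]
    have hr : CMAlgebra.cmFamilyRank (fun j : {j // j ∈ ({i'} : Finset I)} => Φ j.1) = cmTypeRank (Φ i') := by
      rw [← cmFamilyRank_subtype_eq_cmTypeRank Φ i']
      refine (CMAlgebra.cmFamilyRank_comp_of_surjective (fun j : {j // j ∈ ({i'} : Finset I)} => Φ j.1)
        (π := fun j : {j // j = i'} => (⟨j.1, Finset.mem_singleton.2 j.2⟩ : {j // j ∈ ({i'} : Finset I)}))
        fun j => ⟨⟨j.1, Finset.mem_singleton.1 j.2⟩, rfl⟩).symm.trans rfl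
    rw [hr]
  -- the two-block strict inequality for `({i}, T₀ ∖ {i})`
  haveI : Nonempty {j // j ∈ T₀.erase i} := by obtain ⟨j, hj⟩ := hT₀2; exact ⟨⟨j, hj⟩⟩
  have herase : add (T₀.erase i) := hmin _ hT₀2 (Finset.card_erase_lt_of_mem hi)
  have hlt : typeRank (ℂ ≃+* ℂ) {z : (Σ _ : Fin 1, (K i →+* ℂ)) ⊕ (Σ j : {j // j ∈ T₀.erase i}, (K j.1 →+* ℂ)) |
      Sum.elim (· ∈ CMAlgebra.familyType fun _ : Fin 1 => Φ i)
        (· ∈ CMAlgebra.familyType fun j : {j // j ∈ T₀.erase i} => Φ j.1) z} + 1 <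
      CMAlgebra.cmFamilyRank (fun _ : Fin 1 => Φ i) + CMAlgebra.cmFamilyRank (fun j : {j // j ∈ T₀.erase i} => Φ j.1) := by
    rw [typeRank_sum_singleton_erase_eq Φ T₀ hi]
    have h1 : CMAlgebra.cmFamilyRank (fun _ : Fin 1 => Φ i) = cmTypeRank (Φ i) := by
      rw [← cmFamilyRank_subtype_eq_cmTypeRank Φ i]
      exact CMAlgebra.cmFamilyRank_comp_of_surjective (fun j : {j // j = i} => Φ j.1)
        (π := fun _ : Fin 1 => (⟨i, rfl⟩ : {j // j = i})) fun j => ⟨0, by obtain ⟨j, rfl⟩ := j; rfl⟩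
    rw [h1]
    have h2 : ¬ (CMAlgebra.cmFamilyRank (fun j : {j // j ∈ T₀} => Φ j.1) + T₀.card =
        (∑ j ∈ T₀, cmTypeRank (Φ j)) + 1) := hT₀
    have h3 := hle T₀ ⟨i, hi⟩
    have h4 : CMAlgebra.cmFamilyRank (fun j : {j // j ∈ T₀.erase i} => Φ j.1) + (T₀.erase i).card =
        (∑ j ∈ T₀.erase i, cmTypeRank (Φ j)) + 1 := herase
    have h5 := Finset.add_sum_erase T₀ (fun j => cmTypeRank (Φ j)) hi
    have h6 := Finset.card_erase_of_mem hi
    have h7 := Finset.card_pos.2 ⟨i, hi⟩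
    omega
  obtain ⟨a, ha⟩ := exists_not_hodgeClassesProductSpan_of_typeRank_lt_fintype (K₁ := fun _ : Fin 1 => K i)
    (K₂ := fun j : {j // j ∈ T₀.erase i} => K j.1) (Φ₁ := fun _ : Fin 1 => Φ i)
    (Φ₂ := fun j : {j // j ∈ T₀.erase i} => Φ j.1) (A₁ := fun _ : Fin 1 => A i)
    (A₂ := fun j : {j // j ∈ T₀.erase i} => A j.1) (fun _ => hA i) (fun j => hA j.1) hlt
  exact ⟨T₀, i, hi, hT₀, hmin', hbound, (a + 1) * Fintype.card (Fin 1), (a + 1) * Fintype.card {j // j ∈ T₀.erase i},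
    ⟨Nat.mul_ne_zero (Nat.succ_ne_zero a) Fintype.card_ne_zero⟩,
    ⟨Nat.mul_ne_zero (Nat.succ_ne_zero a) Fintype.card_ne_zero⟩,
    fun k => ((Fintype.equivFin {j // j ∈ T₀.erase i}).symm (flatIndex a k)).1,
    fun k => ((Fintype.equivFin {j // j ∈ T₀.erase i}).symm (flatIndex a k)).2, ha⟩

/-- **IF `dim MT(A_i) ≤ q + 1` FOR ALL `i`, THE FIRST EXCEPTIONAL MIXED CLASS LIVES ON AT MOST `q + 1` OF THE FACTORS.**  If
`Hg(∏_i A_i) ⊊ ∏_i Hg(A_i)` and `cmTypeRank Φ_i ≤ q + 1` for all `i`, there is `T₀ ⊆ I` with `|T₀| ≤ q + 1`, `i ∈ T₀` and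
`π₂` with values in `T₀ ∖ {i}` such that `A_i^{N₁} × ⨁_k A_{π₂ k}` has a rational Hodge class outside the span of exterior
products. [cite: MoonenZarhin1999LowDim, §3 (3.1)] [cite: Mai1989, §2 Prop. 1 (proof)] -/
theorem exists_card_le_not_hodgeClassesProductSpan_of_cmTypeRank_le [Nonempty I]
    (hA : ∀ i, IsCMTypeRealisation (Φ i) (A i) (ιA i) (θ i)) (q : ℕ) (hq : ∀ i, cmTypeRank (Φ i) ≤ q + 1)
    (hne : CMAlgebra.cmFamilyRank Φ + Fintype.card I ≠ (∑ i, cmTypeRank (Φ i)) + 1) :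
    ∃ (T₀ : Finset I) (i : I), i ∈ T₀ ∧ T₀.card ≤ q + 1 ∧
      ∃ (N₁ N₂ : ℕ) (_ : NeZero N₁) (_ : NeZero N₂) (π₂ : Fin N₂ → I),
        (∀ k, π₂ k ∈ T₀.erase i) ∧ ¬ HodgeClassesProductSpan (⨁ fun _ : Fin N₁ => A i) (⨁ fun k => A (π₂ k)) := by
  obtain ⟨T₀, i, hi, -, -, hbound, N₁, N₂, hN₁, hN₂, π₂, hπ₂, hnot⟩ :=
    exists_minimal_not_hodgeClassesProductSpan_of_cmFamilyRank_add_card_ne hA hne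
  exact ⟨T₀, i, hi, (hbound i hi).trans (hq i), N₁, N₂, hN₁, hN₂, π₂, hπ₂, hnot⟩

/-- **The degree form**: `[K_i:ℚ] ≤ 2q` (dim A_i ≤ q) for all `i` and `Hg(∏ A_i) ⊊ ∏ Hg(A_i)` ⟹ the first exceptional
mixed class lives on a product of copies of at most `q + 1` of the factors (curves: 2, surfaces: 3, threefolds: 4).
[cite: MoonenZarhin1999LowDim, §3 (3.1)] [cite: Gordon1999HodgeAVSurvey, §3 Theorem and 7.5–7.7] -/
theorem exists_card_le_not_hodgeClassesProductSpan_of_finrank_le [Nonempty I]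
    (hA : ∀ i, IsCMTypeRealisation (Φ i) (A i) (ιA i) (θ i)) (q : ℕ) (hq : ∀ i, Module.finrank ℚ (K i) ≤ 2 * q)
    (hne : CMAlgebra.cmFamilyRank Φ + Fintype.card I ≠ (∑ i, cmTypeRank (Φ i)) + 1) :
    ∃ (T₀ : Finset I) (i : I), i ∈ T₀ ∧ T₀.card ≤ q + 1 ∧
      ∃ (N₁ N₂ : ℕ) (_ : NeZero N₁) (_ : NeZero N₂) (π₂ : Fin N₂ → I),
        (∀ k, π₂ k ∈ T₀.erase i) ∧ ¬ HodgeClassesProductSpan (⨁ fun _ : Fin N₁ => A i) (⨁ fun k => A (π₂ k)) :=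
  exists_card_le_not_hodgeClassesProductSpan_of_cmTypeRank_le hA q (fun i => by
    have h1 := cmTypeRank_le (Φ i)
    have h2 := hq i
    omega) hne

/-- **CM ELLIPTIC CURVES: the failure of `Hg(∏ E_i) = ∏ Hg(E_i)` is visible on a PAIR.**  If all `K_i` are imaginary
quadratic (`[K_i:ℚ] ≤ 2`) and `Hg(∏_i E_i) ⊊ ∏_i Hg(E_i)` (some `E_i ∼ E_j`, `i ≠ j`), then some `E_i^{N₁} × E_j^{N₂}` with
`j ≠ i` carries a rational Hodge class outside the span of exterior products.
[cite: Gordon1999HodgeAVSurvey, §3 Theorem (Imai, Murty)] [cite: MoonenZarhin1999LowDim, §3 (3.1)] -/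
theorem exists_pair_not_hodgeClassesProductSpan_of_finrank_le_two [Nonempty I]
    (hA : ∀ i, IsCMTypeRealisation (Φ i) (A i) (ιA i) (θ i)) (h2 : ∀ i, Module.finrank ℚ (K i) ≤ 2)
    (hne : CMAlgebra.cmFamilyRank Φ + Fintype.card I ≠ (∑ i, cmTypeRank (Φ i)) + 1) :
    ∃ (i j : I), j ≠ i ∧ ∃ (N₁ N₂ : ℕ) (_ : NeZero N₁) (_ : NeZero N₂),
      ¬ HodgeClassesProductSpan (⨁ fun _ : Fin N₁ => A i) (⨁ fun _ : Fin N₂ => A j) := by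
  obtain ⟨T₀, i, hi, hcard, N₁, N₂, hN₁, hN₂, π₂, hπ₂, hnot⟩ :=
    exists_card_le_not_hodgeClassesProductSpan_of_finrank_le hA 1 (fun i => by have := h2 i; omega) hne
  -- `T₀ ∖ {i}` has exactly one element `j`, so `π₂` is constant
  haveI := hN₂
  have hj : (T₀.erase i).card ≤ 1 := by rw [Finset.card_erase_of_mem hi]; omega
  obtain ⟨j, hjmem⟩ : ∃ j, π₂ 0 = j := ⟨_, rfl⟩
  have hconst : ∀ k, π₂ k = j := fun k => by
    have := Finset.card_le_one.1 hj (π₂ k) (hπ₂ k) (π₂ 0) (hπ₂ 0)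
    rw [this, hjmem]
  have hfun : (fun k => A (π₂ k)) = fun _ : Fin N₂ => A j := funext fun k => by rw [hconst k]
  refine ⟨i, j, ?_, N₁, N₂, hN₁, hN₂, ?_⟩
  · have := hπ₂ 0
    rw [hjmem] at this
    exact (Finset.mem_erase.1 this).1
  · rw [← hfun]
    exact hnot

end Summit.HodgeConjecture.CorCM

end
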